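import Literature.NumberTheory.GaloisRepresentations.IdeleClassBarS
import HarnessLib

/-!
# The kernel of `C_E → C̄_S` is `U_{E,S}`: `C_S(E) = C_E ⧸ U_{E,S}` EMBEDS into the `S`-idèle class module `C̄_S`
# (`U_{M,S} ∩ J_E = U_{E,S}`, `U_{M,S}Mˣ ∩ C_E = U_{E,S}` for `E ⊆ M`; Harari Def. 15.38 / Thm. 17.2, NSW (8.3.8)–(8.3.9))

Topic `NumberTheory/GaloisRepresentations`; namespaces `Literature.NumberTheory.GaloisRepresentations.IdeleCohomology` (the
finite tower statements, §1–§2) and `….IdeleClassBar` (the limit statements, §3).  Sequel to `IdeleClassBarS.lean` (D1-(ii):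
`classBarKS K S = C_{K_S}`, `unitsOffKS K S = Ū_S`, `classBarSRep K S = C̄_S = C_{K_S} ⧸ Ū_S`, `toKS`, `ofLayerS`) and to
`IdeleUnitsOffSBaseChange.lean` (D1-(i): `U_{E,S} ↦ U_{E',S}` under base change).  THEOREMS ONLY; no definition, no
named fact, no instance, no `sorry`.  Cell `bsd-eis`, background lane «PT-Ш-S-TC», written `--supports` crux
`GoodLatticeBDPValue` (stmt-BirchSwinnertonDyer-19032).  HONEST FRAMING: bookkeeping of classical objects; no duality
theorem and no case of BSD is proved here.

Mathematics.  Harari Def. 15.38 / proof of Thm. 17.2 and NSW (8.3.8)–(8.3.9) form `C_S = lim→_{F ⊆ K_S} C_F ⧸ U_{F,S}`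
along INJECTIVE transition maps; the injectivity `C_E ⧸ U_{E,S} ↪ C_M ⧸ U_{M,S}` for a finite Galois `M/E` is the
following descent, proved here in the tree's normalisation (`U_{E,S}` = idèles which are local units everywhere, `1` at
infinity and `1` above `S`):
* §1 **`U_{M,S} ∩ J_E = U_{E,S}`** (`mem_unitIdelesOff_iff_ideleBaseChange_mem`): each of the three defining conditions
  of `U_{·,S}` descends along the componentwise-injective base change of idèles (`|x_M|_{w'} = |x_w|^{e}` with `e ≠ 0`,
  every place of `E` lies below one of `M`).
* §2 **`U_{M,S}·Mˣ ∩ C_E = U_{E,S}·Eˣ`** (`mem_range_unitsOffToClass_of_classBaseChange_mem`, `M/E` Galois): if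
  `a_M = u · (k)` with `u ∈ U_{M,S}`, `k ∈ Mˣ`, then for `τ ∈ Gal(M/E)` the idèle `τu/u = k/τk` lies in
  `U_{M,S} ∩ Mˣ = 1` (a principal idèle with trivial infinite part is trivial), so `(k)` is `Gal(M/E)`-fixed, hence
  `k ∈ Eˣ` (the tree's `exists_ideleBaseChange_eq_of_forall_smul_eq`), and `a/k ∈ U_{M,S} ∩ J_E = U_{E,S}`.
* §3 in the limit: for a layer `E ⊆ K_S`, **`[x]_E ∈ Ū_S ↔ x ∈ im(U_{E,S} → C_E)`** (`toKS_mem_unitsOffKS_iff`) and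
  **`ofLayerS x = 0 ↔ x ∈ im(U_{E,S} → C_E)`** (`ofLayerS_eq_zero_iff`): the kernel of `C_E → C̄_S` is exactly
  `U_{E,S}`, i.e. `C_S(E) = C_E ⧸ U_{E,S}` embeds into `C̄_S` (its image lies in `C̄_S^{Gal(K_S/E)}`; equality there is the
  sequel, needing `H¹(Gal(M/E), U_{M,S}) = 0`).

## What is formalised

* §1 (`F ⊆ E ⊆ E'` number fields, `S : Finset (HeightOneSpectrum (𝓞 F))`): `mem_unitIdelesOff_of_ideleBaseChange_mem`,
  **`mem_unitIdelesOff_iff_ideleBaseChange_mem`**.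
* §2 (`E'/E` Galois): **`mem_range_unitsOffToClass_of_classBaseChange_mem`**, `classBaseChange_mem_range_unitsOffToClass_iff`.
* §3 (`K` a number field, layers `E ≤ M` of `K̄/K`, `E ⊆ K_S`): `transHom_mem_range_unitsOffToClass`,
  `mem_range_unitsOffToClass_of_transHom_mem`, **`toKS_mem_unitsOffKS_iff`**, **`ofLayerS_eq_zero_iff`**,
  `ofLayerS_eq_ofLayerS_iff`.

## References
* D. Harari, *Galois Cohomology and Class Field Theory*, Universitext (2020), Def. 15.38, §17.1 Thm. 17.2 (proof). [Harari2020]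
* J. Neukirch, A. Schmidt, K. Wingberg, *Cohomology of Number Fields*, 2nd ed. (2008), VIII §3 (8.3.8)–(8.3.9).
  [NeukirchSchmidtWingberg2008]
* J. W. S. Cassels, A. Fröhlich (eds.), *Algebraic Number Theory* (1967), Ch. VII (J. Tate) §1.1, §8 Prop. 8.1
  (Galois descent for idèles). [CasselsFrohlichANT1967]
-/

noncomputable section

open NumberField IsDedekindDomain CategoryTheory
open Field (absoluteGaloisGroup)
open Literature.NumberTheory.Automorphic Literature.NumberTheory.Automorphic.IdeleClassGroup
open Literature.NumberTheory.NumberFields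
open Literature.Algebra.Homology
open Literature.NumberTheory.GaloisRepresentations.LocalWeilDatum (galFixing)
open scoped Classical

namespace Literature.NumberTheory.GaloisRepresentations

namespace IdeleCohomology

variable {F E E' : Type} [Field F] [NumberField F] [Field E] [NumberField E] [Field E'] [NumberField E']
  [Algebra F E] [Algebra E E'] [Algebra F E'] [IsScalarTower F E E']
variable (S : Finset (HeightOneSpectrum (𝓞 F)))

/-! ## §1. `U_{E',S} ∩ J_E = U_{E,S}` -/

omit [NumberField F] in
/-- **`U_{E',S} ∩ J_E ⊆ U_{E,S}`**: an idèle of `E` whose base change to `E'` is a local unit everywhere, `1` at infinity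
and `1` above `S` has the same three properties (`|x_{E'}|_{w'} = |x_w|_w^{e}` with `e ≠ 0` and every `w` lies below some
`w'`; the infinite and the local base change maps are injective). [cite: CasselsFrohlichANT1967, Ch. VII §1.1]
[cite: NeukirchSchmidtWingberg2008, VIII §3 (8.3.9)] -/
theorem mem_unitIdelesOff_of_ideleBaseChange_mem {x : ideleGroup E}
    (hx : AdeleRing.ideleBaseChange E E' x ∈ IdeleHerbrand.unitIdelesOff F E' S) :
    x ∈ IdeleHerbrand.unitIdelesOff F E S := by
  haveI : Module.Finite E E' := Module.Finite.of_restrictScalars_finite ℚ E E'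
  refine ⟨fun w => ?_, ?_, fun w hw => ?_⟩
  · -- local units: `|x_{E'}|_{w'} = |x_w|^e = 1` with `e ≠ 0`
    obtain ⟨w', rfl⟩ := HeightOneSpectrum.under_surjective (A := 𝓞 E) (B := 𝓞 E') w
    have h := hx.1 w'
    rw [valued_ideleBaseChange_apply] at h
    haveI : w'.asIdeal.LiesOver (w'.under (𝓞 E)).asIdeal := ⟨rfl⟩
    have he : (w'.under (𝓞 E)).asIdeal.ramificationIdx' w'.asIdeal ≠ 0 :=
      Ideal.IsDedekindDomain.ramificationIdx'_ne_zero_of_liesOver w'.asIdeal (w'.under (𝓞 E)).ne_bot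
    have h0 : Valued.v (((x : ideleGroup E) : AdeleRing (𝓞 E) E).2 (w'.under (𝓞 E))) ≠ 0 := by
      intro h0
      rw [h0, zero_pow he] at h
      exact zero_ne_one h
    exact (SemiLocal.withZero_pow_eq_one_iff h0 he).1 h
  · -- infinite part: `(x_{E'})_∞ = (x_∞)_{E'} = 1`
    have h := hx.2.1
    rw [AdeleRing.coe_ideleBaseChange, AdeleRing.baseChange_fst] at h
    exact InfiniteAdeleRing.baseChange_injective E E' (h.trans (map_one _).symm)
  · -- components above `S`: `(x_{E'})_{w'} = ι(x_w) = 1`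
    obtain ⟨w', rfl⟩ := HeightOneSpectrum.under_surjective (A := 𝓞 E) (B := 𝓞 E') w
    have hw' : w'.under (𝓞 F) ∈ S := by rwa [HeightOneSpectrum.under_under F E E' w'] at hw
    have h := hx.2.2 w' hw'
    rw [AdeleRing.coe_ideleBaseChange, AdeleRing.baseChange_snd, FiniteAdeleRing.baseChange_apply] at h
    exact (adicCompletionOfUnder (𝓞 E) E E' w').injective (h.trans (map_one _).symm)

omit [NumberField F] in
/-- **`U_{E',S} ∩ J_E = U_{E,S}`**: `x_{E'} ∈ U_{E',S} ↔ x ∈ U_{E,S}` (with D1-(i) `ideleBaseChange_mem_unitIdelesOff`).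
[cite: NeukirchSchmidtWingberg2008, VIII §3 (8.3.9)] -/
theorem mem_unitIdelesOff_iff_ideleBaseChange_mem (x : ideleGroup E) :
    AdeleRing.ideleBaseChange E E' x ∈ IdeleHerbrand.unitIdelesOff F E' S ↔ x ∈ IdeleHerbrand.unitIdelesOff F E S :=
  ⟨mem_unitIdelesOff_of_ideleBaseChange_mem S, ideleBaseChange_mem_unitIdelesOff S⟩

/-! ## §2. `U_{E',S}·E'ˣ ∩ C_E = U_{E,S}·Eˣ` for `E'/E` Galois -/

/-- **If the base change of a class `c ∈ C_E` lies in the image of `U_{E',S}`, then `c` lies in the image of `U_{E,S}`**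
(`E'/E` Galois).  Writing `c = [a]`, `a_{E'} = u · (k)` with `u ∈ U_{E',S}`, `k ∈ E'ˣ`; for `τ ∈ Gal(E'/E)`,
`(τu)⁻¹ u = (τ(k)) (k)⁻¹ ∈ U_{E',S} ∩ E'ˣ = 1`, so the principal idèle `(k) = u⁻¹ a_{E'}` is `Gal(E'/E)`-fixed, hence
the base change of a principal idèle `(k₀)` of `E` (`exists_ideleBaseChange_eq_of_forall_smul_eq`), and
`(a k₀⁻¹)_{E'} = u ∈ U_{E',S}`, so `a k₀⁻¹ ∈ U_{E,S}` (§1) represents `c`. [cite: CasselsFrohlichANT1967, Ch. VII §8 Prop. 8.1]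
[cite: Harari2020, Def. 15.38, §17.1 Thm. 17.2 (proof)] -/
theorem mem_range_unitsOffToClass_of_classBaseChange_mem [IsGalois E E'] {c : (IdeleClassGroup.galoisRep F E).V}
    (hc : (Additive.ofMul (classBaseChange E E' (Additive.toMul c : IdeleClassGroup E)) :
        (IdeleClassGroup.galoisRep F E').V) ∈ (unitsOffToClass (F := F) (E := E') S).hom.range) :
    c ∈ (unitsOffToClass (F := F) (E := E) S).hom.range := by
  obtain ⟨u, hu⟩ := hc
  obtain ⟨a, ha⟩ := QuotientGroup.mk_surjective (Additive.toMul c : IdeleClassGroup E)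
  set w : IdeleHerbrand.unitIdelesOff F E' S := Additive.toMul u with hw
  -- `[u] = [a_{E'}]` in `C_{E'}`
  have h1 : ((w : ideleGroup E') : IdeleClassGroup E') = (AdeleRing.ideleBaseChange E E' a : IdeleClassGroup E') := by
    have h := congrArg Additive.toMul hu
    rw [toMul_ofMul, ← ha, classBaseChange_mk] at h
    exact h
  -- the principal idèle `p = u⁻¹ a_{E'}`
  have hp : (w : ideleGroup E')⁻¹ * AdeleRing.ideleBaseChange E E' a ∈ principalIdeles E' := QuotientGroup.eq.1 h1
  -- `Gal(E'/E)` fixes `u` and `p`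
  have hfixu : ∀ τ : E' ≃ₐ[E] E', τ • (w : ideleGroup E') = w := by
    intro τ
    have hτw : τ • (w : ideleGroup E') ∈ IdeleHerbrand.unitIdelesOff F E' S := by
      rw [← ideleGroup.smul_eq_smul_of_forall_apply_eq (σ := τ.restrictScalars F) (σ' := τ) (fun _ => rfl)]
      exact IdeleHerbrand.isStable_unitIdelesOff (τ.restrictScalars F) w.2
    -- `(τu)⁻¹ u = τ(p) p⁻¹` is principal with trivial infinite part, hence `1`
    have hq : (τ • (w : ideleGroup E'))⁻¹ * w = 1 := by
      refine eq_one_of_mem_principalIdeles_of_fst_eq_one (E := E') ?_ ?_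
      · have hq' : (τ • (w : ideleGroup E'))⁻¹ * w =
            τ • ((w : ideleGroup E')⁻¹ * AdeleRing.ideleBaseChange E E' a) *
              ((w : ideleGroup E')⁻¹ * AdeleRing.ideleBaseChange E E' a)⁻¹ := by
          rw [smul_mul', smul_inv', AdeleRing.smul_ideleBaseChange, mul_inv_rev, inv_inv, mul_assoc,
            mul_inv_cancel_left]
        rw [hq']
        exact (principalIdeles E').mul_mem (smul_mem_principalIdeles E E' τ hp) ((principalIdeles E').inv_mem hp)
      · exact ((IdeleHerbrand.unitIdelesOff F E' S).mul_mem ((IdeleHerbrand.unitIdelesOff F E' S).inv_mem hτw) w.2).2.1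
    exact inv_injective (inv_eq_of_mul_eq_one_left hq).symm
  have hfix : ∀ τ : E' ≃ₐ[E] E',
      τ • ((w : ideleGroup E')⁻¹ * AdeleRing.ideleBaseChange E E' a) =
        (w : ideleGroup E')⁻¹ * AdeleRing.ideleBaseChange E E' a := fun τ => by
    rw [smul_mul', smul_inv', hfixu τ, AdeleRing.smul_ideleBaseChange]
  -- descent: `p = (k₀)_{E'}` with `k₀ ∈ Eˣ`
  obtain ⟨k₀, hk₀, hk⟩ := exists_ideleBaseChange_eq_of_forall_smul_eq E E' hp hfix
  -- `(a k₀⁻¹)_{E'} = u`, so `a k₀⁻¹ ∈ U_{E,S}`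
  have hbc : AdeleRing.ideleBaseChange E E' (a * k₀⁻¹) = w := by
    rw [map_mul, map_inv, hk, mul_inv_rev, inv_inv, mul_inv_cancel_left]
  have ha' : a * k₀⁻¹ ∈ IdeleHerbrand.unitIdelesOff F E S :=
    mem_unitIdelesOff_of_ideleBaseChange_mem S (by rw [hbc]; exact w.2)
  refine ⟨(Additive.ofMul ⟨a * k₀⁻¹, ha'⟩ : Additive (IdeleHerbrand.unitIdelesOff F E S)), ?_⟩
  -- `[a k₀⁻¹] = [a] = c`
  apply Additive.toMul.injective
  have h2 : (((a * k₀⁻¹ : ideleGroup E)) : IdeleClassGroup E) = (a : IdeleClassGroup E) := by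
    refine QuotientGroup.eq.2 ?_
    rw [mul_inv_rev, inv_inv, inv_mul_cancel_right]
    exact hk₀
  exact h2.trans ha

/-- **`U_{E',S}·E'ˣ ∩ C_E = U_{E,S}·Eˣ`**: the base change of `c ∈ C_E` lies in the image of `U_{E',S}` iff `c` lies in
the image of `U_{E,S}` (`E'/E` Galois; with D1-(i) `classBaseChange_mem_range_unitsOffToClass`).  Equivalently, the induced map
`C_S(E) = C_E ⧸ U_{E,S} → C_S(E') = C_{E'} ⧸ U_{E',S}` is injective. [cite: Harari2020, Def. 15.38, §17.1 Thm. 17.2 (proof)]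
[cite: NeukirchSchmidtWingberg2008, VIII §3 (8.3.8)] -/
theorem classBaseChange_mem_range_unitsOffToClass_iff [IsGalois E E'] (c : (IdeleClassGroup.galoisRep F E).V) :
    (Additive.ofMul (classBaseChange E E' (Additive.toMul c : IdeleClassGroup E)) :
        (IdeleClassGroup.galoisRep F E').V) ∈ (unitsOffToClass (F := F) (E := E') S).hom.range ↔
      c ∈ (unitsOffToClass (F := F) (E := E) S).hom.range :=
  ⟨mem_range_unitsOffToClass_of_classBaseChange_mem S, classBaseChange_mem_range_unitsOffToClass S⟩

end IdeleCohomology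

/-! ## §3. In the limit: the kernel of `C_E → C̄_S` is `U_{E,S}` -/

namespace IdeleClassBar

variable {K : Type} [Field K] [NumberField K] (S : Finset (HeightOneSpectrum (𝓞 K)))

/-- The transition maps of `C̄ = lim→ C_E` map the image of `U_{E,S}` into the image of `U_{M,S}` (D1-(i), with the
case `E = M`). [cite: NeukirchSchmidtWingberg2008, VIII §3 (8.3.9)] -/
theorem transHom_mem_range_unitsOffToClass {E M : GalLayer K} (h : E ≤ M) {c : layerClass K E}
    (hc : haveI := E.numberField; c ∈ (IdeleCohomology.unitsOffToClass (F := K) (E := E.1) S).hom.range) :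
    haveI := M.numberField; transHom E M h c ∈ (IdeleCohomology.unitsOffToClass (F := K) (E := M.1) S).hom.range := by
  by_cases heq : E = M
  · subst heq
    rw [transHom_self]
    exact hc
  haveI := E.numberField
  haveI := M.numberField
  letI := GalLayer.algebraOfLE h
  haveI := GalLayer.isScalarTower_of_le h
  rw [transHom_of_ne h heq]
  exact IdeleCohomology.classBaseChange_mem_range_unitsOffToClass S hc

/-- Conversely, **a class of `C_E` whose image in `C_M` comes from `U_{M,S}` comes from `U_{E,S}`** (`M/E` is Galois,
being a layer of `K̄/K` over a layer). [cite: Harari2020, Def. 15.38, §17.1 Thm. 17.2 (proof)] -/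
theorem mem_range_unitsOffToClass_of_transHom_mem {E M : GalLayer K} (h : E ≤ M) {c : layerClass K E}
    (hc : haveI := M.numberField; transHom E M h c ∈ (IdeleCohomology.unitsOffToClass (F := K) (E := M.1) S).hom.range) :
    haveI := E.numberField; c ∈ (IdeleCohomology.unitsOffToClass (F := K) (E := E.1) S).hom.range := by
  by_cases heq : E = M
  · subst heq
    rw [transHom_self] at hc
    exact hc
  haveI := E.numberField
  haveI := M.numberField
  haveI := M.isGalois
  letI := GalLayer.algebraOfLE h
  haveI := GalLayer.isScalarTower_of_le h
  haveI : IsGalois E.1 M.1 := IsGalois.tower_top_of_isGalois K E.1 M.1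
  rw [transHom_of_ne h heq] at hc
  exact IdeleCohomology.mem_range_unitsOffToClass_of_classBaseChange_mem S hc

/-- **`[x]_E ∈ Ū_S ↔ x ∈ im(U_{E,S} → C_E)`** for a layer `E ⊆ K_S`: if `[x]_E = [u']_{E'}` with `u' ∈ U_{E',S}`, pass to a
common layer `M ⊇ E, E'` inside `K_S` (D1-(i) moves `u'` to `U_{M,S}`, `C_M ↪ C̄`), then descend from `M` to `E` (§2).
[cite: Harari2020, Def. 15.38, §17.1 Thm. 17.2 (proof)][cite: NeukirchSchmidtWingberg2008, VIII §3 (8.3.8)–(8.3.9)] -/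
theorem toKS_mem_unitsOffKS_iff {E : GalLayer K}
    (hE : ramificationSubgroup K (↑S : Set (HeightOneSpectrum (𝓞 K))) ≤ galFixing K E.1) (x : layerClass K E) :
    toKS S hE x ∈ unitsOffKS K S ↔
      (haveI := E.numberField; x ∈ (IdeleCohomology.unitsOffToClass (F := K) (E := E.1) S).hom.range) := by
  constructor
  · rintro ⟨E', hE', u', hu'⟩
    obtain ⟨M, h, h', hM⟩ := exists_ge_ge_insideKS S hE hE'
    obtain ⟨v, hv⟩ := exists_unitsToKS_eq_of_le S h' hE' hM u'
    haveI := M.numberField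
    have h1 : (IdeleCohomology.unitsOffToClass (F := K) (E := M.1) S).hom v = transHom E M h x := by
      apply toKS_injective S hM
      rw [← unitsToKS_apply, hv, hu', toKS_transHom]
    exact mem_range_unitsOffToClass_of_transHom_mem S h ⟨v, h1⟩
  · exact toKS_mem_unitsOffKS_of_mem_range S hE

/-- **The kernel of `C_E → C̄_S` is exactly `U_{E,S}`**: `ofLayerS x = 0 ↔ x ∈ im(U_{E,S} → C_E)`, i.e.
`C_S(E) = C_E ⧸ U_{E,S}` embeds into `C̄_S` (Harari / NSW: `C_S = lim→ C_S(F)` along injective transition maps).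
[cite: Harari2020, Def. 15.38, §17.1 Thm. 17.2 (proof)][cite: NeukirchSchmidtWingberg2008, VIII §3 (8.3.8)] -/
theorem ofLayerS_eq_zero_iff {E : GalLayer K}
    (hE : ramificationSubgroup K (↑S : Set (HeightOneSpectrum (𝓞 K))) ≤ galFixing K E.1) (x : layerClass K E) :
    ofLayerS S hE x = 0 ↔
      (haveI := E.numberField; x ∈ (IdeleCohomology.unitsOffToClass (F := K) (E := E.1) S).hom.range) := by
  rw [ofLayerS_eq_zero_iff_mem, toKS_mem_unitsOffKS_iff]

/-- `ofLayerS x = ofLayerS y ↔ x - y ∈ im(U_{E,S} → C_E)`. [cite: Harari2020, Def. 15.38] -/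
theorem ofLayerS_eq_ofLayerS_iff {E : GalLayer K}
    (hE : ramificationSubgroup K (↑S : Set (HeightOneSpectrum (𝓞 K))) ≤ galFixing K E.1) (x y : layerClass K E) :
    ofLayerS S hE x = ofLayerS S hE y ↔
      (haveI := E.numberField; x - y ∈ (IdeleCohomology.unitsOffToClass (F := K) (E := E.1) S).hom.range) := by
  rw [← sub_eq_zero, ← map_sub, ofLayerS_eq_zero_iff]

end IdeleClassBar

end Literature.NumberTheory.GaloisRepresentations

end
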